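import Mathlib
import Literature.Barriers.PneNP.CorrelationPolytopeXCLowerBoundGraph
import Literature.Barriers.PneNP.ExtendedFormulationMinkowskiFaces
import Literature.Barriers.PneNP.ExtendedFormulationLinearImage
import Summits.ValiantsHypothesis.ValiantsHypothesis.Theorems.FifoMatchingXcDivisionZmixFace
import Summits.ValiantsHypothesis.ValiantsHypothesis.Theorems.FifoMatchingXcDivisionChamberCertificate
import Summits.ValiantsHypothesis.ValiantsHypothesis.Theorems.FifoMatchingNNDivisionHardLowDimDefs
import HarnessLib

/-!
# The coordinate-face TEST FUNCTIONALS for `COR(n) + Q` (val-idea-40's `DimensionRung.lean` §1–§2 + the FMPTW data, named form;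
# class D of line `virtual_passenger`, crux `Theses.FifoMatching.NNDivisionHard`, stmt-ValiantsHypothesis-21181)

Theorems-side port (port hand val-port-1 g3; desk RULING #331 «LowDim PORT»; `--supports stmt-ValiantsHypothesis-21181 --as helper`) of
`Cruxes/NNDivisionHard/DimensionRung.lean` (rev 4 @a45b7939cb12, val-idea-40 g0, sha16 e492007789666bf5; critic of record val-idea-crit-9 g0,
by-name probe DR40d rc 0) §1–§2, and of the FMPTW data of `Cruxes/NNLinearDegreeCofactorHard/Lines/xc_division.lean` §3 (`ud_data`,
named form over the port's `udPt`/`udRow`) that it consumes — proof texts VERBATIM over `…NNDivisionHardLowDimDefs.lean`; the line's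
`hasEFOfSize_face_add` is CITED as val-lit-p10's `HasEFOfSize.face_add_face₁` (`Literature/Barriers/PneNP/ExtendedFormulationMinkowskiFaces.lean`,
same statement) instead of being re-landed; `three_pow_le_of_add` / `quad_two_diag_sub_outer` / `bvec_decide_apply` / `diag_quad` come from
✓ `…XcDivisionChamberCertificate`, `dot_le_of_mem_convexHull` / `mem_convexHull_maximisers` from ✓ `…XcDivisionZmixFace`.

CONTENT: §1 genericity (`exists_large_avoid`, `exists_generic_comb` — a generic combination of finitely many test functions separates
every test point some test function sees); §2 the test functionals `psi S S'` of the coordinate face `F_{S,S'} ≅ COR(n − |S| − |S'|)` are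
bounded by `1` on vertices and CONSTANT on the face (`psi_abs_le`, `psi_face`).  The ★ EXPOSURE RUNG / FLAG LEMMA / ★ DIMENSION RUNG /
★ route-rate theorems are the sibling files `…LowDim{Exposure,Rung,Rate}.lean` (split by the 400-line cap).

HONEST FRAMING: a certificate for a class of passengers (restriction of COR-MINKOWSKI / COR-VIRTUAL); stmt-21181 `NNDivisionHard` OPEN;
`VP ≠ VNP` NOT proved; nothing here is a summit statement.
-/

set_option autoImplicit false

-- the mandated summit-side namespace repeats a component by design (single-problem summit)
set_option linter.dupNamespace false

noncomputable section

open Matrix Finset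
open scoped Pointwise

namespace Summit.ValiantsHypothesis.ValiantsHypothesis.Theorems.FifoMatching

/-! ## The FMPTW data of `COR(n)`, named form (xc_division §3, verbatim over the port's `udInd/udPt/udMat/udRow`) -/

namespace XcDivision

open Literature.Barriers.PneNP (HasEFOfSize)
open Literature.Combinatorics.Optimization.FixedSizePsdRank (Cube vecOuter bvec corPolytope flat
  flat_dotProduct_vecOuter flat_dotProduct_le_of_mem_corPolytope)



/-- `⟨c, d⟩ = Σ_{ij} c_{ij} d_{ij}` for flattened matrices. [folklore] -/
theorem flat_dotProduct_flat {n : ℕ} (c d : Matrix (Fin n) (Fin n) ℝ) :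
    flat c ⬝ᵥ flat d = ∑ i, ∑ j, c i j * d i j := by
  unfold flat dotProduct
  rw [← finProdFinEquiv.sum_comp]
  simp only [Equiv.symm_apply_apply]
  rw [Fintype.sum_prod_type]

/-- the indicator vector, entrywise. -/
theorem udInd_apply {n : ℕ} (a : Finset (Fin n)) (i : Fin n) :
    udInd a i = if i ∈ a then 1 else 0 := bvec_decide_apply a i

/-- indicator entries are idempotent. -/
theorem udInd_sq {n : ℕ} (a : Finset (Fin n)) (i : Fin n) : udInd a i * udInd a i = udInd a i := by
  rw [udInd_apply]; by_cases hi : i ∈ a <;> simp [hi]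

/-- `Σ_i 𝟙_a(i) 𝟙_b(i) = |a ∩ b|`. -/
theorem udInd_inter {n : ℕ} (a b : Finset (Fin n)) : ∑ i, udInd a i * udInd b i = ((a ∩ b).card : ℝ) := by
  classical
  have : ∀ i, udInd a i * udInd b i = if i ∈ a ∩ b then 1 else 0 := fun i => by
    rw [udInd_apply, udInd_apply]
    by_cases ha : i ∈ a <;> by_cases hb : i ∈ b <;> simp [ha, hb]
  simp only [this]
  rw [Finset.sum_boole, Finset.filter_mem_eq_inter, Finset.univ_inter]

/-- **The FMPTW data of `COR(n)`, explicit**: `udPt b ∈ COR(n)`; `udRow a ≤ 1` is valid on `COR(n)`; its slack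
at `udPt b` is `(1 - |a ∩ b|)²`; diagonal functionals evaluate to `Σ_{i∈b} σ_i` at `udPt b`; and `udRow a`
evaluates to `Σ_{i∈a} σ_i` on the diagonal matrix `diag σ`. [cite: FioriniEtAl2015, §4.1 eq. (4), Lemma 6] -/
theorem ud_data (n : ℕ) :
    (∀ b : Finset (Fin n), udPt b ∈ corPolytope n) ∧
      (∀ a : Finset (Fin n), ∀ x ∈ corPolytope n, udRow a ⬝ᵥ x ≤ 1) ∧
      (∀ a b : Finset (Fin n), 1 - udRow a ⬝ᵥ udPt b = (1 - ((a ∩ b).card : ℝ)) ^ 2) ∧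
      (∀ (σ : Fin n → ℝ) (b : Finset (Fin n)), flat (Matrix.diagonal σ) ⬝ᵥ udPt b = ∑ i ∈ b, σ i) := by
  classical
  have pt_mem : ∀ b : Finset (Fin n), udPt b ∈ corPolytope n := fun b =>
    subset_convexHull ℝ _ ⟨fun i => decide (i ∈ b), rfl⟩
  have valid01 : ∀ (a : Finset (Fin n)) (x : Fin n → ℝ), (∀ i, x i = 0 ∨ x i = 1) →
      ∑ i, ∑ j, udMat a i j * (x i * x j) ≤ 1 := by
    intro a x hx
    show ∑ i, ∑ j, (2 * (if i = j then 1 else 0) * udInd a i - udInd a i * udInd a j) * (x i * x j) ≤ 1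
    rw [quad_two_diag_sub_outer]
    have hsq : ∀ i, x i * x i = x i := fun i => by rcases hx i with h | h <;> simp [h]
    simp only [hsq]
    nlinarith [sq_nonneg (∑ i, udInd a i * x i - 1)]
  have slack : ∀ a b : Finset (Fin n), 1 - udRow a ⬝ᵥ udPt b = (1 - ((a ∩ b).card : ℝ)) ^ 2 := by
    intro a b
    show 1 - flat (udMat a) ⬝ᵥ vecOuter n (udInd b) = _
    rw [flat_dotProduct_vecOuter]
    show 1 - ∑ i, ∑ j, (2 * (if i = j then 1 else 0) * udInd a i - udInd a i * udInd a j) *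
      (udInd b i * udInd b j) = _
    rw [quad_two_diag_sub_outer]
    simp only [udInd_sq, udInd_inter]
    ring
  refine ⟨pt_mem, ?_, slack, ?_⟩
  · intro a y hy
    exact flat_dotProduct_le_of_mem_corPolytope hy ⟨(udMat a, 1), fun x hx => valid01 a x hx⟩
  · intro σ b
    show flat (Matrix.diagonal σ) ⬝ᵥ vecOuter n (udInd b) = _
    rw [flat_dotProduct_vecOuter, diag_quad]
    simp only [udInd_apply, mul_ite, mul_one, mul_zero]
    rw [Finset.sum_ite_mem, Finset.univ_inter]
    exact Finset.sum_congr rfl fun i hi => if_pos hi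

/-- `⟨udRow a, diag σ⟩ = Σ_{i ∈ a} σ_i`: the clique rows see a diagonal passenger only through `Σ_{i∈a}`. -/
theorem udRow_dotProduct_flat_diagonal {n : ℕ} (a : Finset (Fin n)) (σ : Fin n → ℝ) :
    udRow a ⬝ᵥ flat (Matrix.diagonal σ) = ∑ i ∈ a, σ i := by
  classical
  rw [udRow, flat_dotProduct_flat]
  have : ∀ i : Fin n, ∑ j, udMat a i j * Matrix.diagonal σ i j = udInd a i * σ i := by
    intro i
    rw [Finset.sum_eq_single i]
    · show (2 * (if i = i then 1 else 0) * udInd a i - udInd a i * udInd a i) * Matrix.diagonal σ i i = _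
      rw [Matrix.diagonal_apply_eq, if_pos rfl, udInd_sq]; ring
    · intro j _ hji; rw [Matrix.diagonal_apply_ne _ (Ne.symm hji), mul_zero]
    · intro hi; exact absurd (Finset.mem_univ i) hi
  simp only [this, udInd_apply, ite_mul, one_mul, zero_mul]
  rw [Finset.sum_ite_mem, Finset.univ_inter]

/-- Linear images distribute over Minkowski sums, keeping the size (`HasEFOfSize.image_linearMap`). -/
theorem hasEFOfSize_image_add {ι κ : Type} [Fintype ι] [Fintype κ] {P Q : Set (ι → ℝ)} {r : ℕ}
    (h : HasEFOfSize (P + Q) r) (L : (ι → ℝ) →ₗ[ℝ] (κ → ℝ)) : HasEFOfSize (L '' P + L '' Q) r := by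
  rw [← Set.image_add]; exact h.image_linearMap L

end XcDivision

/-! ## §1 Genericity: avoiding finitely many linear coincidences (DimensionRung §1, verbatim) -/

namespace LowDim

open Literature.Barriers.PneNP (HasEFOfSize)
open Literature.Combinatorics.Optimization (corPolytopeGraph)
open Literature.Combinatorics.Optimization.FixedSizePsdRank (Cube vecOuter bvec corPolytope flat
  flat_dotProduct_vecOuter)
open Summit.ValiantsHypothesis.ValiantsHypothesis.Theorems.FifoMatching.XcDivision

/-! ## §1 Genericity: avoiding finitely many linear coincidences -/

/-- a real `M > C` with `α M + β ≠ 0` for finitely many `(α, β) ≠ 0`. -/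
theorem exists_large_avoid (s : Finset (ℝ × ℝ)) (hs : ∀ p ∈ s, p.1 ≠ 0 ∨ p.2 ≠ 0) (C : ℝ) :
    ∃ M : ℝ, C < M ∧ ∀ p ∈ s, p.1 * M + p.2 ≠ 0 := by
  refine ⟨|C| + 1 + ∑ p ∈ s, |p.2 / p.1|, ?_, ?_⟩
  · have h1 : C ≤ |C| := le_abs_self C
    have h2 : 0 ≤ ∑ p ∈ s, |p.2 / p.1| := Finset.sum_nonneg fun p _ => abs_nonneg _
    linarith
  · intro p hp
    rcases eq_or_ne p.1 0 with h0 | h0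
    · rcases hs p hp with h | h
      · exact absurd h0 h
      · rw [h0, zero_mul, zero_add]; exact h
    · have hle : |p.2 / p.1| ≤ ∑ p ∈ s, |p.2 / p.1| :=
        Finset.single_le_sum (f := fun p : ℝ × ℝ => |p.2 / p.1|) (fun p _ => abs_nonneg _) hp
      have hC : 0 ≤ |C| := abs_nonneg C
      have hge : -|p.2 / p.1| ≤ p.2 / p.1 := neg_abs_le _
      have hpos : 0 < |C| + 1 + ∑ p ∈ s, |p.2 / p.1| + p.2 / p.1 := by linarith
      have heq : p.1 * (|C| + 1 + ∑ p ∈ s, |p.2 / p.1|) + p.2 =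
          p.1 * (|C| + 1 + ∑ p ∈ s, |p.2 / p.1| + p.2 / p.1) := by
        field_simp
      rw [heq]
      exact mul_ne_zero h0 hpos.ne'

/-- a GENERIC combination of finitely many test functions separates every test point that some test function sees. -/
theorem exists_generic_comb {K E : Type} [Fintype K] [DecidableEq K] (T : Finset E) (ψ : K → E → ℝ) :
    ∃ ε : K → ℝ, ∀ Δ ∈ T, (∃ t, ψ t Δ ≠ 0) → ∑ t, ε t * ψ t Δ ≠ 0 := by
  classical
  suffices h : ∀ s : Finset K, ∃ ε : K → ℝ, (∀ t ∉ s, ε t = 0) ∧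
      ∀ Δ ∈ T, (∃ t ∈ s, ψ t Δ ≠ 0) → ∑ t, ε t * ψ t Δ ≠ 0 by
    obtain ⟨ε, -, hε⟩ := h Finset.univ
    exact ⟨ε, fun Δ hΔ ⟨t, ht⟩ => hε Δ hΔ ⟨t, Finset.mem_univ t, ht⟩⟩
  intro s
  induction s using Finset.induction_on with
  | empty =>
    exact ⟨0, fun _ _ => rfl, fun Δ _ ⟨t, ht, _⟩ => absurd ht (by simp)⟩
  | insert a s ha ih =>
    obtain ⟨ε', hsupp, hsep⟩ := ih
    let pr : E → ℝ × ℝ := fun Δ => (ψ a Δ, ∑ t, ε' t * ψ t Δ)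
    obtain ⟨τ, -, hτ⟩ := exists_large_avoid ((T.image pr).filter fun p => p.1 ≠ 0 ∨ p.2 ≠ 0)
      (fun p hp => (Finset.mem_filter.1 hp).2) 0
    refine ⟨fun t => ε' t + (if t = a then τ else 0), ?_, ?_⟩
    · intro t ht
      rw [Finset.mem_insert, not_or] at ht
      show ε' t + (if t = a then τ else 0) = 0
      rw [hsupp t ht.2, if_neg ht.1, add_zero]
    · intro Δ hΔ hex
      have hsum : ∑ t, (ε' t + (if t = a then τ else 0)) * ψ t Δ =
          (∑ t, ε' t * ψ t Δ) + τ * ψ a Δ := by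
        simp only [add_mul, Finset.sum_add_distrib, ite_mul, zero_mul, Finset.sum_ite_eq',
          Finset.mem_univ, if_true]
      rw [hsum]
      by_cases hpair : ψ a Δ ≠ 0 ∨ ∑ t, ε' t * ψ t Δ ≠ 0
      · have hmem : pr Δ ∈ (T.image pr).filter fun p => p.1 ≠ 0 ∨ p.2 ≠ 0 :=
          Finset.mem_filter.2 ⟨Finset.mem_image_of_mem pr hΔ, hpair⟩
        have hne := hτ (pr Δ) hmem
        intro h0
        apply hne
        show ψ a Δ * τ + ∑ t, ε' t * ψ t Δ = 0
        linarith
      · push Not at hpair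
        obtain ⟨t, ht, hne⟩ := hex
        rw [Finset.mem_insert] at ht
        rcases ht with rfl | ht
        · exact absurd hpair.1 hne
        · exact absurd hpair.2 (hsep Δ hΔ ⟨t, ht, hne⟩)

/-! ## §2 The test functionals of the coordinate face `F_{S,S'}` -/

/-! ## §2 The test functionals of the coordinate face `F_{S,S'}` (DimensionRung §2; `ent`/`psi` are in the Defs file) -/

variable {n : ℕ}

/-- the coordinate functional on a vertex `𝟙_b 𝟙_bᵀ`: `𝟙_b(p) 𝟙_b(q)`. -/
theorem ent_dot_udPt (p q : Fin n) (b : Finset (Fin n)) :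
    ent n p q ⬝ᵥ udPt b = udInd b p * udInd b q := by
  unfold ent udPt
  rw [flat_dotProduct_vecOuter]
  rw [Finset.sum_eq_single_of_mem p (Finset.mem_univ p) (fun i _ hi => by simp [hi])]
  rw [Finset.sum_eq_single_of_mem q (Finset.mem_univ q) (fun j _ hj => by simp [hj])]
  simp

/-- the coordinate functional reads the `(p,q)` entry. -/
theorem ent_dot (p q : Fin n) (x : Fin (n * n) → ℝ) :
    ent n p q ⬝ᵥ x = x (finProdFinEquiv (p, q)) := by
  unfold ent flat dotProduct
  rw [Finset.sum_eq_single_of_mem (finProdFinEquiv (p, q)) (Finset.mem_univ _)]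
  · simp
  · intro i _ hi
    have : ¬ ((finProdFinEquiv.symm i).1 = p ∧ (finProdFinEquiv.symm i).2 = q) := by
      rintro ⟨h1, h2⟩
      apply hi
      have : finProdFinEquiv.symm i = (p, q) := Prod.ext h1 h2
      rw [← this, Equiv.apply_symm_apply]
    show (if (finProdFinEquiv.symm i).1 = p ∧ (finProdFinEquiv.symm i).2 = q then (1 : ℝ) else 0) * x i = 0
    rw [if_neg this, zero_mul]

/-- `𝟙_b(p) 𝟙_b(q) ∈ [0, 1]`. -/
theorem udProd_mem (b : Finset (Fin n)) (p q : Fin n) :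
    0 ≤ udInd b p * udInd b q ∧ udInd b p * udInd b q ≤ 1 := by
  rw [udInd_apply, udInd_apply]
  by_cases hp : p ∈ b <;> by_cases hq : q ∈ b <;> simp [hp, hq]

/-- every test functional is bounded by `1` in absolute value on the vertices of `COR(n)`. -/
theorem psi_abs_le (S S' : Finset (Fin n)) (t : Bool × Fin n × Fin n) (b : Finset (Fin n)) :
    |psi S S' t ⬝ᵥ udPt b| ≤ 1 := by
  obtain ⟨c, p, q⟩ := t
  cases c
  · simp only [psi]
    split_ifs
    · rw [ent_dot_udPt]
      have h1 := udProd_mem b p q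
      rw [abs_le]; constructor <;> linarith [h1.1, h1.2]
    · simp
  · simp only [psi]
    split_ifs
    · simp
    · rw [sub_dotProduct, ent_dot_udPt, ent_dot_udPt]
      have h1 := udProd_mem b p q
      have h2 := udProd_mem b q q
      rw [abs_le]; constructor <;> linarith [h1.1, h1.2, h2.1, h2.2]
    · rw [ent_dot_udPt]
      have h1 := udProd_mem b p q
      rw [abs_le]; constructor <;> linarith [h1.1, h1.2]
    · simp

/-- every test functional is CONSTANT on the vertices of the face `F_{S,S'}` (`S ⊆ b`, `b ∩ S' = ∅`). -/
theorem psi_face (S S' : Finset (Fin n)) (hSS' : Disjoint S S') (t : Bool × Fin n × Fin n)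
    (b : Finset (Fin n)) (hSb : S ⊆ b) (hS'b : Disjoint S' b) :
    psi S S' t ⬝ᵥ udPt b = psi S S' t ⬝ᵥ udPt S := by
  have key : ∀ p ∈ S ∪ S', udInd b p = udInd S p := by
    intro p hp
    rw [udInd_apply, udInd_apply]
    rcases Finset.mem_union.1 hp with h | h
    · rw [if_pos (hSb h), if_pos h]
    · rw [if_neg (Finset.disjoint_left.1 hS'b h), if_neg (Finset.disjoint_left.1 hSS'.symm h)]
  have h01 : ∀ (c : Finset (Fin n)) (i : Fin n), udInd c i = 0 ∨ udInd c i = 1 := by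
    intro c i; rw [udInd_apply]; by_cases h : i ∈ c <;> simp [h]
  obtain ⟨c, p, q⟩ := t
  cases c
  · simp only [psi]
    split_ifs with h
    · rw [ent_dot_udPt, ent_dot_udPt, key p h.1, key q h.2]
    · simp
  · simp only [psi]
    split_ifs with hk hp hp'
    · simp
    · rw [sub_dotProduct, sub_dotProduct, ent_dot_udPt, ent_dot_udPt, ent_dot_udPt, ent_dot_udPt,
        key p (Finset.mem_union_left _ hp)]
      have hqS : udInd S q = 0 := by
        rw [udInd_apply, if_neg (fun h => hk (Finset.mem_union_left _ h))]
      have hpS : udInd S p = 1 := by rw [udInd_apply, if_pos hp]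
      rw [hqS, hpS]
      rcases h01 b q with h | h <;> rw [h]
      ring
    · rw [ent_dot_udPt, ent_dot_udPt, key p (Finset.mem_union_right _ hp')]
      have hpS : udInd S p = 0 := by
        rw [udInd_apply, if_neg (Finset.disjoint_left.1 hSS'.symm hp')]
      rw [hpS]; ring
    · simp

end LowDim

end Summit.ValiantsHypothesis.ValiantsHypothesis.Theorems.FifoMatching

end
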